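import Mathlib
import Literature.Analysis.FluidPDE.HardSphereCollisionRecord
import Literature.MathematicalPhysics.KineticTheory.HardSphereEuler

/-!
# Sketch — first lemmas of the crux ideas for `CollisionActivityTails`
(stmt-AtomisticToContinuum-13734; crux-ideate round 1, ideator 2)

Three idea cards, three first lemmas (stated as `Prop`s over existing declarations; nothing is
proved here):

* `LocalConvexVirial` — card `convex-virial-inertia-cap`: the hard-sphere localized virial
  (Morawetz-type) inequality on `𝕋³`: collisional + kinetic virial inside a ball over a time
  window ≤ inertia (first velocity moments at the two endpoint times, radius-weighted) + kinetic
  and collisional virial of the surrounding shell. Pathwise, deterministic.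
* `EquilibriumLogActivityMGF` and `AprioriHyperactivityFraction` — card
  `log-utility-apriori-fraction`: the equilibrium exponential moment of the CONCAVE utility
  `Σ log(1 + a_i/V)` of the window activities is extensive (`≤ e^{C(N+1)}`), and the a-priori,
  all-times bound on the fraction of hyperactive particles under the true evolution it yields.
* `TiltTransport` — card `reversed-seeding-inefficiency`: the law at time `s` of the flow started
  from a local Gibbs law is the global Gibbs law tilted by the one-body local/global density
  ratio evaluated along the BACKWARD flow (Liouville invariance + energy conservation).
-/

noncomputable section

open MeasureTheory Set
open scoped ENNReal Classical

namespace Summit.AtomisticToContinuum.HydrodynamicLimit.Cruxes.CollisionActivityTails.IdeatorTwo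

open Literature.Analysis.FluidPDE Literature.MathematicalPhysics.KineticTheory

/-- **Localized convex virial inequality for hard spheres on `𝕋³` (card
`convex-virial-inertia-cap`, first lemma).** For a hard-sphere trajectory `γ` of `N` spheres of
diameter `ε` on the unit flat torus, a centre `c`, a radius `R ≥ ε` with `2R + 3ε < 1/2`
(embedded balls), and a window `[s, s + w]`:
the collisional virial of the collisions with BOTH partners in `B_R(c)` (each collision
`ε |v⁺ - v⁻|`, counted once: ordered pairs carry the factor `1/2`) plus the kinetic virial
`∫ Σ_{x_i ∈ B_R} |v_i|²` is at most the INERTIA term `(R + ε)·[P(s) + P(s+w)]`,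
`P(t) = Σ_{x_i(t) ∈ B_{2R+2ε}} |v_i(t)|` (first velocity moments at the two endpoint times only),
plus the kinetic virial of the shell `R < |x - c| ≤ 2R + 2ε` and the collisional virial of the
collisions touching the shell. Proof idea: `G(t) = Σ_i ∇H(x_i)·v_i` for the radial `C^{1,1}`
weight `H = h(|x - c|)`, `h' = r` on `[0, R+ε]`, `h' = 2(R+ε) - r` on `[R+ε, 2R+2ε]`, `0` after:
free flight gives `dG/dt = Σ v_iᵀ D²H v_i` (`D²H = I` inside, eigenvalues `≥ -1` on the shell),
a collision changes `G` by `(∇H(x_i) - ∇H(x_j))·Δv_i = ε |Δv_i| ∫₀¹ ωᵀ D²H ω ∈ ε|Δv_i|·[-1, 1]`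
(`= ε|Δv_i|` when the pair is inside), and `|G| ≤ (R+ε) P`. Vaserstein/Illner's global
`Σ x·v` monotonicity, localized. [cite: CIP1994 App. 4.A; Illner1989; OgawaTsutsumi1991] -/
def LocalConvexVirial : Prop :=
  ∀ (N : ℕ) (ε : ℝ) (γ : ℝ → Config N (Fin 3) T3), 0 < ε →
    IsHardSphereTrajectory (Torus.geometry (Fin 3)) ε N γ →
    ∀ (c : T3) (R s w : ℝ), ε ≤ R → 2 * R + 3 * ε < 1 / 2 → 0 ≤ w →
      (let dc : T3 → ℝ := fun x => Torus.euclidDist x c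
       let inner : HardSphereCollisionRecord (Fin 3) T3 N → Prop :=
         fun r => dc r.fstPos ≤ R ∧ dc r.sndPos ≤ R
       let touch : HardSphereCollisionRecord (Fin 3) T3 N → Prop :=
         fun r => ¬ (dc r.fstPos ≤ R ∧ dc r.sndPos ≤ R) ∧
           (dc r.fstPos ≤ 2 * R + 3 * ε ∨ dc r.sndPos ≤ 2 * R + 3 * ε)
       let virIn : ℝ := collisionSum (Torus.geometry (Fin 3)) ε γ (Icc s (s + w))
         (fun r => if inner r then ε * ‖r.postVel.1 - r.preVel.1‖ / 2 else 0)
       let virSh : ℝ := collisionSum (Torus.geometry (Fin 3)) ε γ (Icc s (s + w))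
         (fun r => if touch r then ε * ‖r.postVel.1 - r.preVel.1‖ / 2 else 0)
       let kinIn : ℝ → ℝ := fun t => ∑ i : Fin N, if dc (γ t i).1 ≤ R then ‖(γ t i).2‖ ^ 2 else 0
       let kinSh : ℝ → ℝ := fun t => ∑ i : Fin N,
         if R < dc (γ t i).1 ∧ dc (γ t i).1 ≤ 2 * R + 2 * ε then ‖(γ t i).2‖ ^ 2 else 0
       let mom : ℝ → ℝ := fun t => ∑ i : Fin N,
         if dc (γ t i).1 ≤ 2 * R + 2 * ε then ‖(γ t i).2‖ else 0
       virIn + ∫ t in s..(s + w), kinIn t ≤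
         (R + ε) * (mom s + mom (s + w)) + (∫ t in s..(s + w), kinSh t) + virSh)

/-- **Extensive equilibrium exponential moment of the log-utility of the window activity (card
`log-utility-apriori-fraction`, first lemma).** Under the GLOBAL canonical Gibbs law (constant
profiles `a₀, 0, θ₀`, flow-invariant) of `N+1` spheres of diameter `σ(N+1)^{-1/3}` on `𝕋³`, the
window activities `a_i = (σ/τ) Σ_{coll of i in (s, s+w]} |v_i⁺ - v_i⁻|`, `w = τ(N+1)^{-1/3}`,
satisfy `E exp(Σ_i log(1 + a_i/V)) = E Π_i (1 + a_i/V) ≤ exp(C (N+1))` with `C` depending on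
`(a₀, θ₀, σ, V)` but NOT on `τ ≥ 1`, `N ≥ N₀(τ)`, `s`, `Φ`. The concave utility tames the
dense-blob family that makes every linear exponential moment of the activity super-extensive
(stmt-14441 witness: gain `log(θ₀/(δ'V))` vs Gibbs cost `3 log(1/(σδ'))` per caged particle).
[cite: stmt-AtomisticToContinuum-14441 REFUTATION; KipnisLandim1999 Ch. 6] -/
def EquilibriumLogActivityMGF : Prop :=
  ∀ (a₀ θ₀ : ℝ), 0 < a₀ → 0 < θ₀ → ∃ σ₀ : ℝ, 0 < σ₀ ∧ ∀ σ : ℝ, 0 < σ → σ < σ₀ →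
    ∀ V : ℝ, 0 < V → ∃ C : ℝ, ∀ τ : ℝ, 1 ≤ τ → ∃ N₀ : ℕ, ∀ N : ℕ, N₀ ≤ N →
      ∀ Φ : HardSphereFlow (Torus.geometry (Fin 3)) (hsDiameter σ N) (N + 1), ∀ s : ℝ,
        (let w : ℝ := τ * ((N : ℝ) + 1) ^ (-(1 / 3 : ℝ))
         let P := localGibbsLaw σ (fun _ => a₀) (fun _ => 0) (fun _ => θ₀) N Φ
         let act := fun (i : Fin (N + 1)) (z : Config (N + 1) (Fin 3) T3) =>
           σ / τ * Φ.collisionSum (Ioc s (s + w))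
             (fun c => if c.fst = i then ‖c.postVel.1 - c.preVel.1‖ else 0) z
         ∫⁻ z, ENNReal.ofReal (Real.exp (∑ i : Fin (N + 1), Real.log (1 + act i z / V))) ∂P ≤
           ENNReal.ofReal (Real.exp (C * ((N : ℝ) + 1))))

/-- **A-priori law of rare hyperactivity, uniform in time (card `log-utility-apriori-fraction`,
the consequence to be docked).** For continuous local Gibbs data there are `σ₀` and, for each
small `σ` and level `V > 0`, a constant `K₀` such that for every horizon `S`, every `K ≥ K₀`,
every `τ ≥ 1`, all large `N`, every flow and EVERY time `s ∈ [0, S]` (no Euler solution, no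
shock-time restriction): the expected FRACTION of particles whose window activity exceeds
`K·V` is at most `K₀ / log K`. Mechanism: `f_s ≤ e^{κ_∞(N+1)} G` pointwise (one-body tilt
bounded once the reference temperature exceeds `sup θ₀`), Jensen, `EquilibriumLogActivityMGF`,
Chebyshev on `log(1 + a/V) ≥ log(1 + K)` on `{a > KV}`. This is the OPTIMAL shape obtainable from
any entropy/density comparison with an invariant reference (utilities growing faster than `log`
have super-extensive equilibrium moments by the blob family). [cite: OllaVaradhanYau1993 §3;
stmt-AtomisticToContinuum-14441 REFUTATION] -/
def AprioriHyperactivityFraction : Prop :=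
  ∀ (a₀ θ₀ : T3 → ℝ) (u₀ : T3 → V3), Continuous a₀ → Continuous θ₀ → Continuous u₀ →
    (∀ x, 0 < a₀ x) → (∀ x, 0 < θ₀ x) → ∃ σ₀ : ℝ, 0 < σ₀ ∧ ∀ σ : ℝ, 0 < σ → σ < σ₀ →
    ∀ V : ℝ, 0 < V → ∃ K₀ : ℝ, 0 < K₀ ∧ ∀ S : ℝ, ∀ K : ℝ, K₀ ≤ K → ∀ τ : ℝ, 1 ≤ τ →
      ∃ N₀ : ℕ, ∀ N : ℕ, N₀ ≤ N →
      ∀ Φ : HardSphereFlow (Torus.geometry (Fin 3)) (hsDiameter σ N) (N + 1),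
      ∀ s ∈ Icc 0 S,
        (let w : ℝ := τ * ((N : ℝ) + 1) ^ (-(1 / 3 : ℝ))
         let P := localGibbsLaw σ a₀ u₀ θ₀ N Φ
         let act := fun (i : Fin (N + 1)) (z : Config (N + 1) (Fin 3) T3) =>
           σ / τ * Φ.collisionSum (Ioc s (s + w))
             (fun c => if c.fst = i then ‖c.postVel.1 - c.preVel.1‖ else 0) z
         ∫⁻ z, ENNReal.ofReal (((N : ℝ) + 1)⁻¹ *
             ∑ i : Fin (N + 1), Set.indicator {y : ℝ | K * V < y} (fun _ => (1 : ℝ)) (act i z)) ∂P ≤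
           ENNReal.ofReal (K₀ / Real.log K))

/-- **Tilt-transport identity (card `reversed-seeding-inefficiency`, first lemma).** The law at
time `s` of the hard-sphere flow started from the local Gibbs law `λ₀ = localGibbsLaw σ a₀ u₀ θ₀`
is absolutely continuous with respect to the GLOBAL Gibbs law `G = localGibbsLaw σ ā 0 θ̄`
(constant profiles; flow-invariant by Liouville's theorem and energy conservation), with density
the one-body tilt `(Z_G/Z_λ) Π_i (a₀ M_{θ₀,u₀} / ā M_{θ̄,0})((Φ_{-s} z)_i)` evaluated along the
BACKWARD flow: `f_s(A) = ∫_A (Z_G/Z_λ) Π_i g̃((Φ_{-s} z)_i) dG(z)`. The starting point of the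
Bayes/time-reversal reformulation `f_s(A) → 0 ⟸ P_G(A at time s | macroscopic profile at time 0)
→ 0 ⟸ seeding inefficiency`. [cite: GST2013 Prop. 4.1.1; OllaVaradhanYau1993 §2] -/
def TiltTransport : Prop :=
  ∀ (σ : ℝ) (a₀ θ₀ : T3 → ℝ) (u₀ : T3 → V3) (abar θbar : ℝ) (N : ℕ)
    (Φ : HardSphereFlow (Torus.geometry (Fin 3)) (hsDiameter σ N) (N + 1)) (s : ℝ)
    (A : Set (Config (N + 1) (Fin 3) T3)), MeasurableSet A → 0 < σ → 0 < abar → 0 < θbar →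
    (∀ x, 0 < a₀ x) → (∀ x, 0 < θ₀ x) → Measurable a₀ → Measurable θ₀ → Measurable u₀ →
      (let G : Geometry (Fin 3) T3 := Torus.geometry (Fin 3)
       let ε : ℝ := hsDiameter σ N
       let fLoc : T3 × V3 → ℝ := localGibbsProfile a₀ u₀ θ₀
       let fG : T3 × V3 → ℝ := localGibbsProfile (fun _ => abar) (fun _ => 0) (fun _ => θbar)
       let ratio : Config (N + 1) (Fin 3) T3 → ℝ := fun z =>
         canonicalPartition G ε (N + 1) fG / canonicalPartition G ε (N + 1) fLoc *
           ∏ i : Fin (N + 1), fLoc (z i) / fG (z i)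
       (Φ.lawAt (localGibbsLaw σ a₀ u₀ θ₀ N Φ) s) A =
         ∫⁻ z in A, ENNReal.ofReal (ratio (Φ.flow (-s) z))
           ∂(localGibbsLaw σ (fun _ => abar) (fun _ => 0) (fun _ => θbar) N Φ))

end Summit.AtomisticToContinuum.HydrodynamicLimit.Cruxes.CollisionActivityTails.IdeatorTwo

end
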